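import Summits.AtomisticToContinuum.HydrodynamicLimit.Theorems.EnskogAdjointDualityAdjointEnskogTestFamilyRSphereCalculusPrep
import Summits.AtomisticToContinuum.HydrodynamicLimit.Theorems.EnskogAdjointDualityAdjointEnskogTestFamilyRSphereCalculusRadial
import Summits.AtomisticToContinuum.HydrodynamicLimit.Theorems.EnskogAdjointDualityAdjointEnskogTestFamilyRHalfGaussian
import Mathlib.MeasureTheory.Integral.DominatedConvergence
import Mathlib.MeasureTheory.Integral.IntegralEqImproper
import Mathlib.MeasureTheory.Function.L2Space
import HarnessLib

/-!
# EnskogAdjointDuality / AdjointEnskogTestFamilyR — refutation line, stub `kernelBridge`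

Registered stub `stub_kernelBridge` of the line `refutation` of the crux K2R
`Summit.AtomisticToContinuum.HydrodynamicLimit.Theses.EnskogAdjointDuality.AdjointEnskogTestFamilyR`
(stmt-AtomisticToContinuum-11592): the bridge between the explicit dual gain kernels on `ℝ³ × S²`
and their one-dimensional profiles.

* **Zonal reduction** (`k2r_ref_kb_sphere`). The dual kernels
  `I(U, ν) = ½ e^{-(|U|² - ⟪U,ν⟫²)/2} h(⟪U,ν⟫) T(⟪U,ν⟫²)` depend on `ν ∈ S²` only through the height
  `⟪U, ν⟫ = |U| ⟪Û, ν⟫`; Archimedes' hat-box law `∫_{S²} g(⟪Û,ν⟫) dσ = 2π ∫_{-1}^{1} g` and the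
  degree-one Funk–Hecke formula `∫_{S²} g(⟪Û,ν⟫) ν dσ = (2π ∫_{-1}^{1} t g) Û` (taken as a
  hypothesis) turn `∫ I dσ`, `∫ I ν dσ`, `∫ ν₀ ⟪U,ν⟫ I dσ` into the profiles `g0, g2, g1` of the
  registered signature. Integrability on the sphere: the kernels are continuous in `ν`
  (`h` is continuous by the landed stub `stub_halfGaussian`; the tails `x ↦ ∫_{x}^{∞} ϑ` are
  continuous on `[0, ∞)` by `IntegrableOn.continuousOn_Ici_primitive_Ioi`).
* **Polar coordinates** for the radial weight `(1 + |U|²)|k(|U|²)|` and the dipole weight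
  `|U₀|(1 + |U|²)|k(|U|²)|`: `∫_{ℝ³} F(|U|) dU = 4π ∫₀^∞ r² F(r) dr`, the separated formula
  `∫ f = (∫_{S²} Y dσ) ∫₀^∞ r² φ` (`f(rω) = φ(r) Y(ω)`, here `Y(ω) = |ω₀|`, `∫_{S²} |ω₀| dσ = 2π`),
  and the substitution `E = r²` (`∫₀^∞ 2r g(r²) dr = ∫₀^∞ g`), with the integrability transfer
  `integrableOn_Ioi_comp_rpow_iff'`.

References: Archimedes' hat-box theorem and Funk–Hecke in degree one [folklore].
-/

noncomputable section

open MeasureTheory Set Filter Metric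
open scoped InnerProductSpace Real

namespace Summit.AtomisticToContinuum.HydrodynamicLimit.Theorems.EnskogAdjointDuality

open Literature.MathematicalPhysics.KineticTheory
open Summit.AtomisticToContinuum.HydrodynamicLimit.Theorems.ClampedCorrectorBirth

/-! ### Two elementary integrals -/

/-- `∫_{S²} |ω₀| dσ(ω) = 2π` (hat-box law along the first axis and `∫_{-1}^{1} |x| dx = 1`).
[folklore] -/
theorem k2r_ref_kb_integral_abs_coord :
    ∫ ω : sphere (0 : EuclideanSpace ℝ (Fin 3)) 1, |(ω : EuclideanSpace ℝ (Fin 3)) 0| ∂sphereMeasure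
      = 2 * π := by
  rw [k2r_ref_integral_sphere_coord 0 (g := fun x => |x|) continuous_abs.aestronglyMeasurable]
  have h1 : ∫ x in (-1 : ℝ)..1, |x| = 1 := by
    rw [← intervalIntegral.integral_add_adjacent_intervals (b := 0)
      (continuous_abs.intervalIntegrable _ _) (continuous_abs.intervalIntegrable _ _)]
    have e1 : ∫ x in (-1 : ℝ)..0, |x| = ∫ x in (-1 : ℝ)..0, -x :=
      intervalIntegral.integral_congr fun x hx => by
        rw [uIcc_of_le (by norm_num)] at hx
        exact abs_of_nonpos hx.2
    have e2 : ∫ x in (0 : ℝ)..1, |x| = ∫ x in (0 : ℝ)..1, x :=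
      intervalIntegral.integral_congr fun x hx => by
        rw [uIcc_of_le zero_le_one] at hx
        exact abs_of_nonneg hx.1
    rw [e1, e2, intervalIntegral.integral_neg, integral_id, integral_id]
    norm_num
  rw [h1, mul_one]

/-- The dipole radial weight `√E (1+E)⁻⁴ e^{-E/R}` is integrable on `(0, ∞)` for `R > 0`
(it is at most `e^{-E/R}`). [folklore] -/
theorem k2r_ref_kb_integrableOn_th1 {R : ℝ} (hR : 0 < R) :
    IntegrableOn (fun E : ℝ => Real.sqrt E * ((1 + E) ^ 4)⁻¹ * Real.exp (-E / R)) (Ioi 0) := by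
  refine k2r_ref_integrableOn_Ioi_of_le ?_ (k2r_ref_integrableOn_exp_neg_div hR) fun E hE => ?_
  · refine (Real.continuous_sqrt.continuousOn.mul
      (ContinuousOn.inv₀ (by fun_prop) fun E hE => ?_)).mul (Continuous.continuousOn (by fun_prop))
    exact (pow_pos (by linarith [mem_Ioi.1 hE] : (0 : ℝ) < 1 + E) 4).ne'
  · have h1 : Real.sqrt E ≤ (1 + E) ^ 4 := by
      have hs := Real.sqrt_nonneg E
      have hs2 := Real.sq_sqrt hE.le
      calc Real.sqrt E ≤ 1 + E := by nlinarith [sq_nonneg (Real.sqrt E - 1)]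
        _ ≤ (1 + E) ^ 4 := le_self_pow₀ (by linarith) (by norm_num)
    rw [abs_of_nonneg (by positivity)]
    calc Real.sqrt E * ((1 + E) ^ 4)⁻¹ * Real.exp (-E / R)
        ≤ (1 + E) ^ 4 * ((1 + E) ^ 4)⁻¹ * Real.exp (-E / R) := by gcongr
      _ = Real.exp (-E / R) := by rw [mul_inv_cancel₀ (by positivity), one_mul]

/-! ### Zonal reduction of the explicit dual kernels -/

/-- **Zonal reduction of the dual kernels.** For continuous `h`, a tail profile `T` continuous on
`[0, ∞)`, the degree-one Funk–Hecke formula (hypothesis) and `U ∈ ℝ³`, the kernel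
`I(ν) = ½ e^{-(|U|² - ⟪U,ν⟫²)/2} h(⟪U,ν⟫) T(⟪U,ν⟫²)` and its dipole partner `ν₀ ⟪U,ν⟫ I(ν)` are
`σ`-integrable on `S²`, and with `E = |U|²`, `Q(t) = e^{-E(1-t²)/2} h(|U| t) T(E t²)`:
`∫ I dσ = π ∫_{-1}^{1} Q`, `∫ I ν dσ = ((π ∫ t Q)/|U|) U`, `∫ ν₀ ⟪U,ν⟫ I dσ = U₀ π ∫ t² Q`
(write `U = |U| Û` and apply the hat-box law to the profile `½ Q(⟪Û, ν⟫)`). [folklore] -/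
theorem k2r_ref_kb_sphere {h T : ℝ → ℝ} (hh : Continuous h) (hT : ContinuousOn T (Ici 0))
    (hFH : ∀ (a : EuclideanSpace ℝ (Fin 3)), ‖a‖ = 1 → ∀ g : ℝ → ℝ, ContinuousOn g (Set.Icc (-1) 1) →
      (∫ ν : Metric.sphere (0 : EuclideanSpace ℝ (Fin 3)) 1,
          g (inner ℝ a (ν : EuclideanSpace ℝ (Fin 3))) • (ν : EuclideanSpace ℝ (Fin 3)) ∂sphereMeasure)
        = (2 * Real.pi * ∫ t in (-1 : ℝ)..1, t * g t) • a)
    (U : EuclideanSpace ℝ (Fin 3)) :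
    let I : EuclideanSpace ℝ (Fin 3) → ℝ := fun n =>
      (1 / 2 : ℝ) * Real.exp (-(‖U‖ ^ 2 - inner ℝ U n ^ 2) / 2) * h (inner ℝ U n) * T (inner ℝ U n ^ 2)
    Integrable (fun ν : Metric.sphere (0 : EuclideanSpace ℝ (Fin 3)) 1 => I ν) sphereMeasure ∧
    Integrable (fun ν : Metric.sphere (0 : EuclideanSpace ℝ (Fin 3)) 1 =>
      (ν : EuclideanSpace ℝ (Fin 3)) 0 * inner ℝ U (ν : EuclideanSpace ℝ (Fin 3)) * I ν) sphereMeasure ∧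
    (∫ ν : Metric.sphere (0 : EuclideanSpace ℝ (Fin 3)) 1, I ν ∂sphereMeasure) =
      Real.pi * ∫ t in (-1 : ℝ)..1,
        Real.exp (-(‖U‖ ^ 2 * (1 - t ^ 2)) / 2) * h (‖U‖ * t) * T (‖U‖ ^ 2 * t ^ 2) ∧
    (∫ ν : Metric.sphere (0 : EuclideanSpace ℝ (Fin 3)) 1,
        I ν • (ν : EuclideanSpace ℝ (Fin 3)) ∂sphereMeasure) =
      ((Real.pi * ∫ t in (-1 : ℝ)..1,
        t * Real.exp (-(‖U‖ ^ 2 * (1 - t ^ 2)) / 2) * h (‖U‖ * t) * T (‖U‖ ^ 2 * t ^ 2)) / ‖U‖) • U ∧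
    (∫ ν : Metric.sphere (0 : EuclideanSpace ℝ (Fin 3)) 1,
        (ν : EuclideanSpace ℝ (Fin 3)) 0 * inner ℝ U (ν : EuclideanSpace ℝ (Fin 3)) * I ν ∂sphereMeasure) =
      U 0 * (Real.pi * ∫ t in (-1 : ℝ)..1,
        t ^ 2 * Real.exp (-(‖U‖ ^ 2 * (1 - t ^ 2)) / 2) * h (‖U‖ * t) * T (‖U‖ ^ 2 * t ^ 2)) := by
  intro I
  -- a unit vector `a` with `U = |U| a`
  obtain ⟨a, ha, hUa⟩ : ∃ a : EuclideanSpace ℝ (Fin 3), ‖a‖ = 1 ∧ U = ‖U‖ • a := by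
    by_cases hU : U = 0
    · refine ⟨EuclideanSpace.single 0 1, by simp, ?_⟩
      rw [hU, norm_zero, zero_smul]
    · have hne : ‖U‖ ≠ 0 := norm_ne_zero_iff.2 hU
      refine ⟨‖U‖⁻¹ • U, ?_, ?_⟩
      · rw [norm_smul, norm_inv, norm_norm, inv_mul_cancel₀ hne]
      · rw [smul_smul, mul_inv_cancel₀ hne, one_smul]
  have hin : ∀ ν : sphere (0 : EuclideanSpace ℝ (Fin 3)) 1,
      ⟪U, (ν : EuclideanSpace ℝ (Fin 3))⟫_ℝ = ‖U‖ * ⟪a, (ν : EuclideanSpace ℝ (Fin 3))⟫_ℝ := fun ν => by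
    conv_lhs => rw [hUa]
    exact real_inner_smul_left _ _ _
  have hU0 : U 0 = ‖U‖ * a 0 := by
    conv_lhs => rw [hUa]
    rfl
  -- the zonal profile `Q` and the dipole profile `G`
  set Q : ℝ → ℝ := fun t =>
    Real.exp (-(‖U‖ ^ 2 * (1 - t ^ 2)) / 2) * h (‖U‖ * t) * T (‖U‖ ^ 2 * t ^ 2) with hQ
  have hQc : Continuous Q := by
    have h1 : Continuous fun t : ℝ => T (‖U‖ ^ 2 * t ^ 2) :=
      hT.comp_continuous (by fun_prop) fun t => mem_Ici.2 (by positivity)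
    have h2 : Continuous fun t : ℝ => h (‖U‖ * t) := hh.comp (by fun_prop)
    have h3 : Continuous fun t : ℝ => Real.exp (-(‖U‖ ^ 2 * (1 - t ^ 2)) / 2) := by fun_prop
    exact (h3.mul h2).mul h1
  have hIQ : ∀ ν : sphere (0 : EuclideanSpace ℝ (Fin 3)) 1,
      I ν = 1 / 2 * Q ⟪a, (ν : EuclideanSpace ℝ (Fin 3))⟫_ℝ := fun ν => by
    show (1 / 2 : ℝ) * Real.exp (-(‖U‖ ^ 2 - ⟪U, (ν : EuclideanSpace ℝ (Fin 3))⟫_ℝ ^ 2) / 2) *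
        h ⟪U, (ν : EuclideanSpace ℝ (Fin 3))⟫_ℝ * T (⟪U, (ν : EuclideanSpace ℝ (Fin 3))⟫_ℝ ^ 2) = _
    rw [hin ν, mul_pow, hQ]
    dsimp only
    rw [show -(‖U‖ ^ 2 - ‖U‖ ^ 2 * ⟪a, (ν : EuclideanSpace ℝ (Fin 3))⟫_ℝ ^ 2) / 2 =
        -(‖U‖ ^ 2 * (1 - ⟪a, (ν : EuclideanSpace ℝ (Fin 3))⟫_ℝ ^ 2)) / 2 by ring]
    ring
  have hQin : Continuous fun ν : sphere (0 : EuclideanSpace ℝ (Fin 3)) 1 =>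
      Q ⟪a, (ν : EuclideanSpace ℝ (Fin 3))⟫_ℝ :=
    hQc.comp (continuous_const.inner continuous_subtype_val)
  have hIeq : (fun ν : sphere (0 : EuclideanSpace ℝ (Fin 3)) 1 => I ν) =
      fun ν : sphere (0 : EuclideanSpace ℝ (Fin 3)) 1 =>
        1 / 2 * Q ⟪a, (ν : EuclideanSpace ℝ (Fin 3))⟫_ℝ := funext hIQ
  have hc0 : Continuous fun ν : sphere (0 : EuclideanSpace ℝ (Fin 3)) 1 =>
      (ν : EuclideanSpace ℝ (Fin 3)) 0 :=
    (EuclideanSpace.proj (0 : Fin 3)).continuous.comp continuous_subtype_val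
  have hcin : Continuous fun ν : sphere (0 : EuclideanSpace ℝ (Fin 3)) 1 =>
      ⟪U, (ν : EuclideanSpace ℝ (Fin 3))⟫_ℝ := continuous_const.inner continuous_subtype_val
  set G : ℝ → ℝ := fun t => ‖U‖ / 2 * (t * Q t) with hG
  have hGc : Continuous G := continuous_const.mul (continuous_id.mul hQc)
  set e0 : EuclideanSpace ℝ (Fin 3) := EuclideanSpace.single 0 1 with he0
  have hIG : ∀ ν : sphere (0 : EuclideanSpace ℝ (Fin 3)) 1,
      (ν : EuclideanSpace ℝ (Fin 3)) 0 * ⟪U, (ν : EuclideanSpace ℝ (Fin 3))⟫_ℝ * I ν =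
        ⟪e0, G ⟪a, (ν : EuclideanSpace ℝ (Fin 3))⟫_ℝ • (ν : EuclideanSpace ℝ (Fin 3))⟫_ℝ := fun ν => by
    rw [real_inner_smul_right, he0, EuclideanSpace.inner_single_left, map_one, one_mul, hIQ ν, hin ν,
      hG]
    ring
  have hFint : Integrable (fun ν : sphere (0 : EuclideanSpace ℝ (Fin 3)) 1 =>
      G ⟪a, (ν : EuclideanSpace ℝ (Fin 3))⟫_ℝ • (ν : EuclideanSpace ℝ (Fin 3))) sphereMeasure :=
    integrable_sphere_of_continuous'
      ((hGc.comp (continuous_const.inner continuous_subtype_val)).smul continuous_subtype_val)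
  refine ⟨?_, ?_, ?_, ?_, ?_⟩
  · rw [hIeq]
    exact integrable_sphere_of_continuous' (continuous_const.mul hQin)
  · have h1 : (fun ν : sphere (0 : EuclideanSpace ℝ (Fin 3)) 1 =>
        (ν : EuclideanSpace ℝ (Fin 3)) 0 * ⟪U, (ν : EuclideanSpace ℝ (Fin 3))⟫_ℝ * I ν) =
        fun ν : sphere (0 : EuclideanSpace ℝ (Fin 3)) 1 =>
          (ν : EuclideanSpace ℝ (Fin 3)) 0 * ⟪U, (ν : EuclideanSpace ℝ (Fin 3))⟫_ℝ *
            (1 / 2 * Q ⟪a, (ν : EuclideanSpace ℝ (Fin 3))⟫_ℝ) := funext fun ν => by rw [hIQ]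
    rw [h1]
    exact integrable_sphere_of_continuous' ((hc0.mul hcin).mul (continuous_const.mul hQin))
  · -- `∫ I dσ = π ∫ Q`
    rw [hIeq, integral_sphere_comp_inner_real ha (g := fun t => 1 / 2 * Q t)
      (continuous_const.mul hQc).aestronglyMeasurable,
      ← intervalIntegral.integral_const_mul, ← intervalIntegral.integral_const_mul]
    exact intervalIntegral.integral_congr fun t _ => by simp only [hQ]; ring
  · -- `∫ I ν dσ = ((π ∫ t Q)/|U|) U`
    have h1 : (fun ν : sphere (0 : EuclideanSpace ℝ (Fin 3)) 1 => I ν • (ν : EuclideanSpace ℝ (Fin 3))) =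
        fun ν : sphere (0 : EuclideanSpace ℝ (Fin 3)) 1 =>
          (1 / 2 * Q ⟪a, (ν : EuclideanSpace ℝ (Fin 3))⟫_ℝ) • (ν : EuclideanSpace ℝ (Fin 3)) :=
      funext fun ν => by rw [hIQ]
    rw [h1, hFH a ha (fun t => 1 / 2 * Q t) (continuous_const.mul hQc).continuousOn]
    by_cases hU : U = 0
    · subst hU
      have hz : ∀ t : ℝ, Q t = h 0 * T 0 := fun t => by simp [hQ]
      rw [smul_zero]
      simp_rw [hz]
      rw [intervalIntegral.integral_mul_const, integral_id]
      norm_num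
    · have hne : ‖U‖ ≠ 0 := norm_ne_zero_iff.2 hU
      have key : ∀ c : ℝ, (c / ‖U‖) • U = c • a := fun c => by
        conv_lhs => rw [hUa]
        rw [norm_smul, norm_norm, ha, mul_one, smul_smul, div_mul_cancel₀ _ hne]
      rw [key]
      congr 1
      rw [← intervalIntegral.integral_const_mul, ← intervalIntegral.integral_const_mul]
      exact intervalIntegral.integral_congr fun t _ => by simp only [hQ]; ring
  · -- `∫ ν₀ ⟪U,ν⟫ I dσ = U₀ π ∫ t² Q`
    calc ∫ ν : sphere (0 : EuclideanSpace ℝ (Fin 3)) 1,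
          (ν : EuclideanSpace ℝ (Fin 3)) 0 * ⟪U, (ν : EuclideanSpace ℝ (Fin 3))⟫_ℝ * I ν ∂sphereMeasure
        = ∫ ν : sphere (0 : EuclideanSpace ℝ (Fin 3)) 1,
            ⟪e0, G ⟪a, (ν : EuclideanSpace ℝ (Fin 3))⟫_ℝ • (ν : EuclideanSpace ℝ (Fin 3))⟫_ℝ
              ∂sphereMeasure := integral_congr_ae (Eventually.of_forall hIG)
      _ = ⟪e0, (2 * π * ∫ t in (-1 : ℝ)..1, t * G t) • a⟫_ℝ := by
          rw [integral_inner (𝕜 := ℝ) hFint, hFH a ha G hGc.continuousOn]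
      _ = (2 * π * ∫ t in (-1 : ℝ)..1, t * G t) * a 0 := by
          rw [real_inner_smul_right, he0, EuclideanSpace.inner_single_left, map_one, one_mul]
      _ = _ := by
          have h2 : ∫ t in (-1 : ℝ)..1, t * G t = ‖U‖ / 2 * ∫ t in (-1 : ℝ)..1,
              t ^ 2 * Real.exp (-(‖U‖ ^ 2 * (1 - t ^ 2)) / 2) * h (‖U‖ * t) * T (‖U‖ ^ 2 * t ^ 2) := by
            rw [← intervalIntegral.integral_const_mul]
            exact intervalIntegral.integral_congr fun t _ => by simp only [hG, hQ]; ring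
          rw [h2, hU0]
          ring

/-! ### Registered stub -/

/-- **Registered stub `stub_kernelBridge`** (line `refutation` of crux K2R
`Summit.AtomisticToContinuum.HydrodynamicLimit.Theses.EnskogAdjointDuality.AdjointEnskogTestFamilyR`):
the explicit dual gain kernels `I0 R U ν`, `I1 R U ν` on `ℝ³ × S²` are `σ`-integrable and their
sphere integrals are the one-dimensional profiles `g0, g2, g1` (hat-box law / Funk–Hecke in the
height `⟪U, ν⟫ = |U| t`), and the radial resp. dipole velocity weights integrate over `ℝ³` by polar
coordinates and the substitution `E = r²`:
`∫ (1+|U|²)|k(|U|²)| dU = 2π ∫₀^∞ (1+E)√E|k(E)| dE`,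
`∫ |U₀|(1+|U|²)|k(|U|²)| dU = π ∫₀^∞ (1+E)E|k(E)| dE` — verbatim registered signature. [folklore] -/
theorem stub_kernelBridge :
  let φ₁ : ℝ → ℝ := fun b => Real.exp (-b ^ 2 / 2) / Real.sqrt (2 * Real.pi)
  let h : ℝ → ℝ := fun a => ∫ b, max (a - b) 0 * φ₁ b
  let th0 : ℝ → ℝ → ℝ := fun R E => ((1 + E) ^ 3)⁻¹ * Real.exp (-E / R)
  let th1 : ℝ → ℝ → ℝ := fun R E => Real.sqrt E * ((1 + E) ^ 4)⁻¹ * Real.exp (-E / R)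
  let Tb0 : ℝ → ℝ → ℝ := fun R x => ∫ E in Set.Ioi x, th0 R E
  let Tb1 : ℝ → ℝ → ℝ := fun R x => ∫ E in Set.Ioi x, th1 R E
  let I0 : ℝ → EuclideanSpace ℝ (Fin 3) → EuclideanSpace ℝ (Fin 3) → ℝ := fun R U n =>
    (1 / 2 : ℝ) * Real.exp (-(‖U‖ ^ 2 - inner ℝ U n ^ 2) / 2) * h (inner ℝ U n) * Tb0 R (inner ℝ U n ^ 2)
  let I1 : ℝ → EuclideanSpace ℝ (Fin 3) → EuclideanSpace ℝ (Fin 3) → ℝ := fun R U n =>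
    n 0 * inner ℝ U n *
      ((1 / 2 : ℝ) * Real.exp (-(‖U‖ ^ 2 - inner ℝ U n ^ 2) / 2) * h (inner ℝ U n) * Tb1 R (inner ℝ U n ^ 2))
  let g0 : ℝ → ℝ → ℝ := fun R E => Real.pi * ∫ t in (-1 : ℝ)..1,
    Real.exp (-(E * (1 - t ^ 2)) / 2) * h (Real.sqrt E * t) * Tb0 R (E * t ^ 2)
  let g1 : ℝ → ℝ → ℝ := fun R E => Real.pi * ∫ t in (-1 : ℝ)..1,
    t ^ 2 * Real.exp (-(E * (1 - t ^ 2)) / 2) * h (Real.sqrt E * t) * Tb1 R (E * t ^ 2)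
  let g2 : ℝ → ℝ → ℝ := fun R E => Real.pi * ∫ t in (-1 : ℝ)..1,
    t * Real.exp (-(E * (1 - t ^ 2)) / 2) * h (Real.sqrt E * t) * Tb0 R (E * t ^ 2)
  (∀ (a : EuclideanSpace ℝ (Fin 3)), ‖a‖ = 1 → ∀ g : ℝ → ℝ, ContinuousOn g (Set.Icc (-1) 1) →
    (∫ ν : Metric.sphere (0 : EuclideanSpace ℝ (Fin 3)) 1,
        g (inner ℝ a (ν : EuclideanSpace ℝ (Fin 3))) • (ν : EuclideanSpace ℝ (Fin 3)) ∂sphereMeasure)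
      = (2 * Real.pi * ∫ t in (-1 : ℝ)..1, t * g t) • a) →
  ∀ R : ℝ, 1 ≤ R →
    (∀ U : EuclideanSpace ℝ (Fin 3),
      Integrable (fun ν : Metric.sphere (0 : EuclideanSpace ℝ (Fin 3)) 1 => I0 R U ν) sphereMeasure ∧
      Integrable (fun ν : Metric.sphere (0 : EuclideanSpace ℝ (Fin 3)) 1 => I1 R U ν) sphereMeasure ∧
      (∫ ν : Metric.sphere (0 : EuclideanSpace ℝ (Fin 3)) 1, I0 R U ν ∂sphereMeasure) = g0 R (‖U‖ ^ 2) ∧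
      (∫ ν : Metric.sphere (0 : EuclideanSpace ℝ (Fin 3)) 1,
          I0 R U ν • (ν : EuclideanSpace ℝ (Fin 3)) ∂sphereMeasure) = (g2 R (‖U‖ ^ 2) / ‖U‖) • U ∧
      (∫ ν : Metric.sphere (0 : EuclideanSpace ℝ (Fin 3)) 1, I1 R U ν ∂sphereMeasure) = U 0 * g1 R (‖U‖ ^ 2)) ∧
    (∀ k : ℝ → ℝ, Measurable k →
      IntegrableOn (fun E => (1 + E) * Real.sqrt E * |k E|) (Set.Ioi 0) →
      Integrable (fun U : EuclideanSpace ℝ (Fin 3) => (1 + ‖U‖ ^ 2) * |k (‖U‖ ^ 2)|) ∧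
      ∫ U : EuclideanSpace ℝ (Fin 3), (1 + ‖U‖ ^ 2) * |k (‖U‖ ^ 2)| =
        2 * Real.pi * ∫ E in Set.Ioi (0 : ℝ), (1 + E) * Real.sqrt E * |k E|) ∧
    (∀ k : ℝ → ℝ, Measurable k →
      IntegrableOn (fun E => (1 + E) * E * |k E|) (Set.Ioi 0) →
      Integrable (fun U : EuclideanSpace ℝ (Fin 3) => |U 0| * (1 + ‖U‖ ^ 2) * |k (‖U‖ ^ 2)|) ∧
      ∫ U : EuclideanSpace ℝ (Fin 3), |U 0| * (1 + ‖U‖ ^ 2) * |k (‖U‖ ^ 2)| =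
        Real.pi * ∫ E in Set.Ioi (0 : ℝ), (1 + E) * E * |k E|) := by
  intro φ₁ h th0 th1 Tb0 Tb1 I0 I1 g0 g1 g2 hFH R hR
  have hR0 : 0 < R := by linarith
  have hh : Continuous h := stub_halfGaussian.1.1
  have hth0 : IntegrableOn (th0 R) (Ioi 0) :=
    (k2r_ref_integrableOn_moment hR0 (Nat.zero_le 3)).congr_fun (fun E _ =>
      show E ^ 0 * ((1 + E) ^ 3)⁻¹ * Real.exp (-E / R) = ((1 + E) ^ 3)⁻¹ * Real.exp (-E / R) by
        rw [pow_zero, one_mul]) measurableSet_Ioi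
  have hth1 : IntegrableOn (th1 R) (Ioi 0) := k2r_ref_kb_integrableOn_th1 hR0
  have hT0 : ContinuousOn (Tb0 R) (Ici 0) := hth0.continuousOn_Ici_primitive_Ioi
  have hT1 : ContinuousOn (Tb1 R) (Ici 0) := hth1.continuousOn_Ici_primitive_Ioi
  refine ⟨fun U => ?_, fun k hk hkI => ?_, fun k hk hkI => ?_⟩
  · -- the sphere integrals of the dual kernels
    have h0 := k2r_ref_kb_sphere hh hT0 hFH U
    have h1 := k2r_ref_kb_sphere hh hT1 hFH U
    refine ⟨h0.1, h1.2.1, h0.2.2.1.trans ?_, h0.2.2.2.1.trans ?_, h1.2.2.2.2.trans ?_⟩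
    · simp only [g0]
      rw [Real.sqrt_sq (norm_nonneg U)]
    · simp only [g2]
      rw [Real.sqrt_sq (norm_nonneg U)]
    · simp only [g1]
      rw [Real.sqrt_sq (norm_nonneg U)]
  · -- polar coordinates for the radial weight
    have hsub : IntegrableOn (fun r : ℝ => r ^ 2 * ((1 + r ^ 2) * |k (r ^ 2)|)) (Ioi 0) := by
      have h1 := (integrableOn_Ioi_comp_rpow_iff' (fun E => (1 + E) * Real.sqrt E * |k E|)
        two_ne_zero).2 hkI
      refine h1.congr_fun (fun r hr => ?_) measurableSet_Ioi
      have hr' : (0 : ℝ) ≤ r := le_of_lt hr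
      simp only [smul_eq_mul]
      rw [show (2 : ℝ) - 1 = 1 by norm_num, Real.rpow_one, Real.rpow_two, Real.sqrt_sq hr']
      ring
    refine ⟨(k2r_ref_integrable_radial_iff (fun r => (1 + r ^ 2) * |k (r ^ 2)|)).2 hsub, ?_⟩
    have hrad : ∫ U : EuclideanSpace ℝ (Fin 3), (1 + ‖U‖ ^ 2) * |k (‖U‖ ^ 2)| =
        4 * π * ∫ r in Ioi (0 : ℝ), r ^ 2 * ((1 + r ^ 2) * |k (r ^ 2)|) :=
      k2r_ref_integral_radial (fun r => (1 + r ^ 2) * |k (r ^ 2)|)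
    rw [hrad, ← k2r_ref_integral_comp_sq (fun E => (1 + E) * Real.sqrt E * |k E|)]
    have h2 : ∫ r in Ioi (0 : ℝ), 2 * r * ((1 + r ^ 2) * Real.sqrt (r ^ 2) * |k (r ^ 2)|) =
        ∫ r in Ioi (0 : ℝ), 2 * (r ^ 2 * ((1 + r ^ 2) * |k (r ^ 2)|)) :=
      setIntegral_congr_fun measurableSet_Ioi fun r hr => by
        rw [Real.sqrt_sq (le_of_lt hr)]
        ring
    rw [h2, integral_const_mul]
    ring
  · -- polar coordinates for the dipole weight
    have hsub : IntegrableOn (fun r : ℝ => r ^ 2 * (r * ((1 + r ^ 2) * |k (r ^ 2)|))) (Ioi 0) := by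
      have h1 := (integrableOn_Ioi_comp_rpow_iff' (fun E => (1 + E) * E * |k E|) two_ne_zero).2 hkI
      refine h1.congr_fun (fun r _ => ?_) measurableSet_Ioi
      simp only [smul_eq_mul]
      rw [show (2 : ℝ) - 1 = 1 by norm_num, Real.rpow_one, Real.rpow_two]
      ring
    have hdom : Integrable (fun U : EuclideanSpace ℝ (Fin 3) => ‖U‖ * ((1 + ‖U‖ ^ 2) * |k (‖U‖ ^ 2)|)) :=
      (k2r_ref_integrable_radial_iff (fun r => r * ((1 + r ^ 2) * |k (r ^ 2)|))).2 hsub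
    have hint : Integrable
        (fun U : EuclideanSpace ℝ (Fin 3) => |U 0| * (1 + ‖U‖ ^ 2) * |k (‖U‖ ^ 2)|) := by
      refine hdom.mono' (Measurable.aestronglyMeasurable (by fun_prop))
        (Eventually.of_forall fun U => ?_)
      rw [Real.norm_eq_abs, abs_of_nonneg (by positivity)]
      have h0 : |U 0| ≤ ‖U‖ := by simpa using PiLp.norm_apply_le U 0
      calc |U 0| * (1 + ‖U‖ ^ 2) * |k (‖U‖ ^ 2)| ≤ ‖U‖ * (1 + ‖U‖ ^ 2) * |k (‖U‖ ^ 2)| := by gcongr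
        _ = ‖U‖ * ((1 + ‖U‖ ^ 2) * |k (‖U‖ ^ 2)|) := mul_assoc _ _ _
    refine ⟨hint, ?_⟩
    have hfac : ∀ r : ℝ, 0 < r → ∀ ω : sphere (0 : EuclideanSpace ℝ (Fin 3)) 1,
        |(r • (ω : EuclideanSpace ℝ (Fin 3))) 0| * (1 + ‖r • (ω : EuclideanSpace ℝ (Fin 3))‖ ^ 2) *
            |k (‖r • (ω : EuclideanSpace ℝ (Fin 3))‖ ^ 2)| =
          r * ((1 + r ^ 2) * |k (r ^ 2)|) * |(ω : EuclideanSpace ℝ (Fin 3)) 0| := fun r hr ω => by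
      have hn : ‖r • (ω : EuclideanSpace ℝ (Fin 3))‖ = r := by
        rw [norm_smul, Real.norm_eq_abs, abs_of_pos hr, norm_eq_of_mem_sphere ω, mul_one]
      rw [hn, PiLp.smul_apply, smul_eq_mul, abs_mul, abs_of_pos hr]
      ring
    rw [k2r_ref_integral_polar hint (fun r => r * ((1 + r ^ 2) * |k (r ^ 2)|))
      (fun ω => |(ω : EuclideanSpace ℝ (Fin 3)) 0|) hfac, k2r_ref_kb_integral_abs_coord,
      ← k2r_ref_integral_comp_sq (fun E => (1 + E) * E * |k E|)]
    have h2 : ∫ r in Ioi (0 : ℝ), 2 * r * ((1 + r ^ 2) * r ^ 2 * |k (r ^ 2)|) =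
        ∫ r in Ioi (0 : ℝ), 2 * (r ^ 2 * (r * ((1 + r ^ 2) * |k (r ^ 2)|))) :=
      setIntegral_congr_fun measurableSet_Ioi fun r _ => by ring
    rw [h2, integral_const_mul]
    ring

end Summit.AtomisticToContinuum.HydrodynamicLimit.Theorems.EnskogAdjointDuality

end
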